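import Summits.SmoothPoincare4.SmoothPoincare4.Theorems.EntropyRungSubcylindricalRecognitionConeHelpers
import Literature.Topology.FourManifolds.WhitneyModelSheets
import HarnessLib

/-!
# Cone exclusion for line `ancient-sphere-rigidity` — the test function

Crux `EntropyRung.SubcylindricalRecognition` (stmt-SmoothPoincare4-10869), line `ancient-sphere-rigidity`,
skeleton r6 (lead glue). `coneTestFunction` (registered helper): on a closed 4-manifold with metric `h`
containing the `(1-η)`-expanding `k`-sheeted image `Φ(A)` of the annulus `A = {ε < |y| < r'}` with the
descent `ρ` of `|y|²`, the function `w = W ∘ ρ'` (`ρ'` the zero extension of `ρ`, `W` the radial profile of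
`profile_props`) is smooth on `M`, has values in `[0,1]`, vanishes off `Φ(A)`, and obeys the pointwise bounds
`4|∇w|² ≤ F₁ := 16 ρ' W'(ρ')²/(1-η)` and `R w² ≤ Λ w²`. Fact-free.
-/

noncomputable section

open scoped Manifold ContDiff Topology ENNReal NNReal ContinuousMap
open Set MeasureTheory Filter
open Literature.Geometry.Lorentzian Literature.Geometry.Riemannian

namespace Summit.SmoothPoincare4.SmoothPoincare4.Theorems.SubcylindricalRecognition.AncientSphereRigidity

/-- **The cone test function.** On a closed Riemannian 4-manifold containing the almost-isometric
`k`-sheeted image `Φ(A)` of the annulus `A = {ε < |y| < r'}` with the descent `ρ` of `|y|²`: the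
function `w = W ∘ ρ'` (`ρ'` = zero extension of `ρ`, `W` the radial profile of `profile_props`) is smooth on
`M`, takes values in `[0,1]`, vanishes off `Φ(A)`, and satisfies the pointwise bounds `4|∇w|² ≤ F₁`,
`R w² ≤ Λ w²` with the continuous auxiliary integrands `F₁ = 16 ρ' W'(ρ')²/(1-η)`, `f₂ = -w² log w²`.
[folklore] -/
theorem coneTestFunction :
    ∀
      (M : Type) [TopologicalSpace M] [T2Space M] [SecondCountableTopology M]
      [ChartedSpace (EuclideanSpace ℝ (Fin 4)) M] [IsManifold (𝓡 4) ∞ M] [CompactSpace M]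
      [T3Space M] [MeasurableSpace M] [BorelSpace M]
      (h : PseudoRiemannianMetric (𝓡 4) ∞ (EuclideanSpace ℝ (Fin 4)) (TangentSpace (𝓡 4) : M → Type _))
      (cov : CovariantDerivative (𝓡 4) (EuclideanSpace ℝ (Fin 4)) (TangentSpace (𝓡 4) : M → Type _))
      (η τ Λ ε r' : ℝ) (hη1 : η < 1) (hτ : 0 < τ) (hε : 0 < ε) (hr' : 0 < r')
      (Φ : EuclideanSpace ℝ (Fin 4) → M) (ρ : M → ℝ)
      (hΦ : ContMDiffOn (𝓡 4) (𝓡 4) ∞ Φ (Metric.ball 0 r' \ Metric.closedBall 0 ε))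
      (hopen : IsOpen (Φ '' (Metric.ball 0 r' \ Metric.closedBall 0 ε)))
      (hmf : ∀ y ∈ Metric.ball (0 : EuclideanSpace ℝ (Fin 4)) r' \ Metric.closedBall 0 ε,
        Function.Injective (mfderiv (𝓡 4) (𝓡 4) Φ y))
      (hρ : ContMDiffOn (𝓡 4) 𝓘(ℝ, ℝ) ∞ ρ (Φ '' (Metric.ball 0 r' \ Metric.closedBall 0 ε)))
      (hdesc : ∀ y ∈ Metric.ball (0 : EuclideanSpace ℝ (Fin 4)) r' \ Metric.closedBall 0 ε,
        ρ (Φ y) = ‖y‖ ^ 2)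
      (hcomp : ∀ y ∈ Metric.ball (0 : EuclideanSpace ℝ (Fin 4)) r' \ Metric.closedBall 0 ε,
        ∀ v : EuclideanSpace ℝ (Fin 4),
          (1 - η) * ‖v‖ ^ 2 ≤ h.val (Φ y) (mfderiv (𝓡 4) (𝓡 4) Φ y v) (mfderiv (𝓡 4) (𝓡 4) Φ y v))
      (hRΛ : ∀ y ∈ Metric.ball (0 : EuclideanSpace ℝ (Fin 4)) r' \ Metric.closedBall 0 ε,
        |h.scalarCurvatureWith cov (Φ y)| ≤ Λ),
      ∃ (W : ℝ → ℝ) (w F₁ f₂ : M → ℝ),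
        (W = fun s : ℝ ↦ Real.exp (-s / (8 * τ)) *
          (Real.smoothTransition (s / (2 * ε ^ 2) - 1) * Real.smoothTransition (3 - 4 * s / r' ^ 2))) ∧
        ContDiff ℝ ∞ W ∧ (∀ s, 0 ≤ W s) ∧ (∀ s, 0 ≤ s → W s ≤ 1) ∧
        (∀ s, 2 * ε ^ 2 < s → s < 3 * r' ^ 2 / 4 → 0 < W s) ∧
        ContMDiff (𝓡 4) 𝓘(ℝ, ℝ) ∞ w ∧ Continuous F₁ ∧ Continuous f₂ ∧
        (∀ x, 0 ≤ w x) ∧ (∀ x, w x ≤ 1) ∧ (∀ x, 0 ≤ F₁ x) ∧ (∀ x, 0 ≤ f₂ x) ∧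
        (∀ x, f₂ x = -(w x ^ 2 * Real.log (w x ^ 2))) ∧
        (∀ x ∉ Φ '' (Metric.ball 0 r' \ Metric.closedBall 0 ε), w x = 0) ∧
        (∀ x ∉ Φ '' (Metric.ball 0 r' \ Metric.closedBall 0 ε), F₁ x = 0) ∧
        (∀ y ∈ Metric.ball (0 : EuclideanSpace ℝ (Fin 4)) r' \ Metric.closedBall 0 ε,
          w (Φ y) = W (‖y‖ ^ 2)) ∧
        (∀ y ∈ Metric.ball (0 : EuclideanSpace ℝ (Fin 4)) r' \ Metric.closedBall 0 ε,
          F₁ (Φ y) = 16 * ‖y‖ ^ 2 * (deriv W (‖y‖ ^ 2)) ^ 2 / (1 - η)) ∧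
        (∀ x, 4 * h.gradSq w x ≤ F₁ x) ∧
        (∀ x, h.scalarCurvatureWith cov x * w x ^ 2 ≤ Λ * w x ^ 2) := by
  intro M _ _ _ _ _ _ _ _ _ h cov η τ Λ ε r' hη1 hτ hε hr' Φ ρ hΦ hopen hmf hρ hdesc hcomp hRΛ
  classical
  -- ### sets (opaque abbreviations with defining equations)
  obtain ⟨A, hA⟩ : ∃ A : Set (EuclideanSpace ℝ (Fin 4)), A = Metric.ball 0 r' \ Metric.closedBall 0 ε :=
    ⟨_, rfl⟩
  rw [← hA] at hΦ hopen hmf hρ hdesc hcomp hRΛ ⊢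
  obtain ⟨V, hV⟩ : ∃ V : Set M, V = Φ '' A := ⟨_, rfl⟩
  rw [← hV] at hopen hρ
  have hAo : IsOpen A := by rw [hA]; exact Metric.isOpen_ball.sdiff Metric.isClosed_closedBall
  have hmemA : ∀ {y : EuclideanSpace ℝ (Fin 4)}, y ∈ A ↔ ε < ‖y‖ ∧ ‖y‖ < r' := by
    intro y
    simp only [hA, Set.mem_sdiff, Metric.mem_ball, dist_zero_right, Metric.mem_closedBall, not_le]
    tauto
  obtain ⟨C, hC⟩ : ∃ C : Set (EuclideanSpace ℝ (Fin 4)),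
      C = {y | 3 * ε ^ 2 / 2 ≤ ‖y‖ ^ 2 ∧ ‖y‖ ^ 2 ≤ 7 * r' ^ 2 / 8} := ⟨_, rfl⟩
  have hmemC : ∀ {y : EuclideanSpace ℝ (Fin 4)}, y ∈ C ↔ 3 * ε ^ 2 / 2 ≤ ‖y‖ ^ 2 ∧
      ‖y‖ ^ 2 ≤ 7 * r' ^ 2 / 8 := by intro y; rw [hC]; rfl
  have hCA : C ⊆ A := by
    intro y hy
    rw [hmemC] at hy
    rw [hmemA, ← abs_of_nonneg (norm_nonneg y), ← abs_of_pos hε, ← abs_of_pos hr', ← sq_lt_sq,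
      ← sq_lt_sq]
    constructor
    · linarith only [hy.1, sq_nonneg ε, pow_pos hε 2]
    · linarith only [hy.2, pow_pos hr' 2]
  have hnsq : Continuous fun y : EuclideanSpace ℝ (Fin 4) ↦ ‖y‖ ^ 2 := by fun_prop
  have hCclosed : IsClosed C := by
    rw [hC]
    exact (isClosed_le continuous_const hnsq).inter (isClosed_le hnsq continuous_const)
  have hAsub : A ⊆ Metric.closedBall (0 : EuclideanSpace ℝ (Fin 4)) r' := by
    rw [hA]; exact Set.sdiff_subset.trans Metric.ball_subset_closedBall
  have hCcpt : IsCompact C :=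
    Metric.isCompact_of_isClosed_isBounded hCclosed (Metric.isBounded_closedBall.subset (hCA.trans hAsub))
  obtain ⟨K, hK⟩ : ∃ K : Set M, K = Φ '' C := ⟨_, rfl⟩
  have hKcpt : IsCompact K := hK ▸ hCcpt.image_of_continuousOn (hΦ.continuousOn.mono hCA)
  have hKclosed : IsClosed K := hKcpt.isClosed
  have hKV : K ⊆ V := by rw [hK, hV]; exact image_mono hCA
  have hKrep : ∀ x ∈ K, ∃ y ∈ C, Φ y = x := fun x hx ↦ (mem_image _ _ _).mp (hK ▸ hx)
  have hmemK : ∀ y ∈ C, Φ y ∈ K := fun y hy ↦ hK ▸ mem_image_of_mem Φ hy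
  -- ### the profile `W`
  obtain ⟨W, hWdef⟩ : ∃ W : ℝ → ℝ, W = fun s : ℝ ↦ Real.exp (-s / (8 * τ)) *
      (Real.smoothTransition (s / (2 * ε ^ 2) - 1) * Real.smoothTransition (3 - 4 * s / r' ^ 2)) :=
    ⟨_, rfl⟩
  obtain ⟨hWsmooth, hW0, hW1, hWflat, hWpos⟩ := profile_props hτ hε hr' W hWdef
  have hWdiff : Differentiable ℝ W := hWsmooth.differentiable (by simp)
  have hW'cont : Continuous (deriv W) := hWsmooth.continuous_deriv (by simp)
  have hW00 : W 0 = 0 := (hWflat 0 (Or.inl (by positivity))).1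
  -- off `C` (inside `A`) the profile and its derivative vanish at `|y|²`
  have hflatA : ∀ y ∈ A, y ∉ C → W (‖y‖ ^ 2) = 0 ∧ deriv W (‖y‖ ^ 2) = 0 := by
    intro y _ hyC
    apply hWflat
    rw [hmemC, not_and_or, not_le, not_le] at hyC
    rcases hyC with h1 | h1
    · left; linarith only [h1, pow_pos hε 2]
    · right; linarith only [h1, pow_pos hr' 2]
  -- ### facts about `Φ`, `ρ` on `A`, `V`; the zero extension `ρ'` of `ρ`
  have hΦmem : ∀ y ∈ A, Φ y ∈ V := fun y hy ↦ hV ▸ mem_image_of_mem Φ hy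
  have hVrep : ∀ x ∈ V, ∃ y ∈ A, Φ y = x := fun x hx ↦ (mem_image _ _ _).mp (hV ▸ hx)
  have hAV : Set.MapsTo Φ A V := fun y hy ↦ hΦmem y hy
  obtain ⟨ρ', hρ'def⟩ : ∃ ρ' : M → ℝ, ρ' = V.indicator ρ := ⟨_, rfl⟩
  have hρ'V : ∀ x ∈ V, ρ' x = ρ x := fun x hx ↦ by rw [hρ'def]; exact indicator_of_mem hx _
  have hρ'Vc : ∀ x ∉ V, ρ' x = 0 := fun x hx ↦ by rw [hρ'def]; exact indicator_of_notMem hx _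
  have hρ's : ContMDiffOn (𝓡 4) 𝓘(ℝ, ℝ) ∞ ρ' V := hρ.congr (fun x hx ↦ hρ'V x hx)
  have hρ'cont : ContinuousOn ρ' V := hρ's.continuousOn
  have hdesc' : ∀ y ∈ A, ρ' (Φ y) = ‖y‖ ^ 2 := fun y hy ↦ by rw [hρ'V _ (hΦmem y hy), hdesc y hy]
  have hρ'_nn : ∀ x, 0 ≤ ρ' x := by
    intro x; by_cases hx : x ∈ V
    · obtain ⟨y, hy, rfl⟩ := hVrep x hx
      rw [hdesc' y hy]; positivity
    · rw [hρ'Vc x hx]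
  -- ### the test function `w = W ∘ ρ'`, the auxiliary integrands `F₁`, `f₂`
  obtain ⟨w, hwdef⟩ : ∃ w : M → ℝ, w = fun x ↦ W (ρ' x) := ⟨_, rfl⟩
  obtain ⟨F₁, hF₁def⟩ : ∃ F₁ : M → ℝ, F₁ = fun x ↦ 16 * ρ' x * (deriv W (ρ' x)) ^ 2 / (1 - η) :=
    ⟨_, rfl⟩
  obtain ⟨f₂, hf₂def⟩ : ∃ f₂ : M → ℝ, f₂ = fun x ↦ -(w x ^ 2 * Real.log (w x ^ 2)) := ⟨_, rfl⟩
  have hwapp : ∀ x, w x = W (ρ' x) := fun x ↦ by rw [hwdef]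
  have hF₁app : ∀ x, F₁ x = 16 * ρ' x * (deriv W (ρ' x)) ^ 2 / (1 - η) := fun x ↦ by rw [hF₁def]
  have hf₂app : ∀ x, f₂ x = -(w x ^ 2 * Real.log (w x ^ 2)) := fun x ↦ by rw [hf₂def]
  have hwVc : ∀ x ∉ V, w x = 0 := fun x hx ↦ by rw [hwapp, hρ'Vc x hx, hW00]
  have hF₁Vc : ∀ x ∉ V, F₁ x = 0 := fun x hx ↦ by rw [hF₁app, hρ'Vc x hx]; simp
  have hwΦ : ∀ y ∈ A, w (Φ y) = W (‖y‖ ^ 2) := fun y hy ↦ by rw [hwapp, hdesc' y hy]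
  have hF₁Φ : ∀ y ∈ A, F₁ (Φ y) = 16 * ‖y‖ ^ 2 * (deriv W (‖y‖ ^ 2)) ^ 2 / (1 - η) := fun y hy ↦ by
    rw [hF₁app, hdesc' y hy]
  -- both vanish off `K`
  have hw0K : ∀ x ∉ K, w x = 0 := by
    intro x hx
    by_cases hxV : x ∈ V
    · obtain ⟨y, hy, rfl⟩ := hVrep x hxV
      have hyC : y ∉ C := fun hyC ↦ hx (hmemK y hyC)
      rw [hwΦ y hy, (hflatA y hy hyC).1]
    · exact hwVc x hxV
  have hF₁0K : ∀ x ∉ K, F₁ x = 0 := by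
    intro x hx
    by_cases hxV : x ∈ V
    · obtain ⟨y, hy, rfl⟩ := hVrep x hxV
      have hyC : y ∉ C := fun hyC ↦ hx (hmemK y hyC)
      rw [hF₁Φ y hy, (hflatA y hy hyC).2]; simp
    · exact hF₁Vc x hxV
  -- smoothness / continuity by zero extension
  have hWm : ContMDiff 𝓘(ℝ, ℝ) 𝓘(ℝ, ℝ) ∞ W := hWsmooth.contMDiff
  have hwV_smooth : ContMDiffOn (𝓡 4) 𝓘(ℝ, ℝ) ∞ w V := by
    rw [hwdef]; exact hWm.comp_contMDiffOn hρ's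
  have hws : ContMDiff (𝓡 4) 𝓘(ℝ, ℝ) ∞ w :=
    contMDiff_of_contMDiffOn_of_eq_zero hopen hKclosed hKV hwV_smooth hw0K
  have hwc : Continuous w := hws.continuous
  have hw2c : Continuous fun x ↦ w x ^ 2 := hwc.pow 2
  have hF₁V_cont : ContinuousOn F₁ V := by
    rw [hF₁def]
    exact ((continuousOn_const.mul hρ'cont).mul ((hW'cont.comp_continuousOn hρ'cont).pow 2)).div_const _
  have hF₁c : Continuous F₁ :=
    continuous_of_continuousOn_of_eq_zero hopen hKclosed hKV hF₁V_cont hF₁0K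
  have hf₂c : Continuous f₂ := by
    rw [hf₂def]; exact (Real.continuous_mul_log.comp hw2c).neg
  -- signs and sizes
  have h1η : 0 < 1 - η := by linarith only [hη1]
  have hw_nn : ∀ x, 0 ≤ w x := fun x ↦ by rw [hwapp]; exact hW0 _
  have hw_le : ∀ x, w x ≤ 1 := fun x ↦ by rw [hwapp]; exact hW1 _ (hρ'_nn x)
  have hF₁_nn : ∀ x, 0 ≤ F₁ x := fun x ↦ by
    rw [hF₁app]
    exact div_nonneg (mul_nonneg (mul_nonneg (by norm_num) (hρ'_nn x)) (sq_nonneg _)) h1η.le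
  have hf₂_nn : ∀ x, 0 ≤ f₂ x := by
    intro x
    rw [hf₂app]
    have h0 := hw_nn x
    have h1 : w x ^ 2 ≤ 1 := by
      have := hw_le x
      calc w x ^ 2 = w x * w x := sq _
        _ ≤ 1 * 1 := mul_le_mul this this h0 zero_le_one
        _ = 1 := one_mul _
    have h2 : Real.log (w x ^ 2) ≤ 0 := Real.log_nonpos (sq_nonneg _) h1
    have h3 : w x ^ 2 * Real.log (w x ^ 2) ≤ 0 := mul_nonpos_of_nonneg_of_nonpos (sq_nonneg _) h2
    linarith only [h3]
  -- ### pointwise bound `4 |∇w|² ≤ F₁`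
  have htsupp : tsupport w ⊆ K := closure_minimal (fun x hx ↦ by
    by_contra hxK; exact hx (hw0K x hxK)) hKclosed
  have hgrad_le : ∀ x, 4 * h.gradSq w x ≤ F₁ x := by
    intro x
    by_cases hxV : x ∈ V
    · obtain ⟨y, hy, rfl⟩ := hVrep x hxV
      have hρd : MDifferentiableAt (𝓡 4) 𝓘(ℝ, ℝ) ρ' (Φ y) :=
        ((hρ's _ hxV).contMDiffAt (hopen.mem_nhds hxV)).mdifferentiableAt (by simp)
      have h2 : h.gradSq w (Φ y) = (deriv W (ρ' (Φ y))) ^ 2 * h.gradSq ρ' (Φ y) := by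
        rw [hwdef]; exact h.gradSq_real_comp (hWdiff _).hasDerivAt hρd
      have h3 : h.gradSq ρ' (Φ y) ≤ 4 * ‖y‖ ^ 2 / (1 - η) :=
        gradSq_descent_le M h hη1 hAo hopen hΦ hρ's hAV hdesc' hy (hmf y hy)
          (fun v ↦ hcomp y hy v)
      rw [h2, hF₁Φ y hy, hdesc' y hy]
      have h4 : 0 ≤ (deriv W (‖y‖ ^ 2)) ^ 2 := sq_nonneg _
      calc 4 * (deriv W (‖y‖ ^ 2) ^ 2 * h.gradSq ρ' (Φ y))
          ≤ 4 * (deriv W (‖y‖ ^ 2) ^ 2 * (4 * ‖y‖ ^ 2 / (1 - η))) := by gcongr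
        _ = 16 * ‖y‖ ^ 2 * deriv W (‖y‖ ^ 2) ^ 2 / (1 - η) := by ring
    · -- off `V ⊇ K`, `w` vanishes near `x`
      have hxK : x ∉ tsupport w := fun hxK ↦ hxV (hKV (htsupp hxK))
      have h1 : h.gradSq w x = 0 :=
        h.gradSq_eq_zero_of_mvfderiv_eq_zero
          (Literature.Geometry.Lorentzian.mvfderiv_eq_zero_of_notMem_tsupport hxK)
      rw [h1, hF₁Vc x hxV]; simp
  -- ### pointwise bound `R w² ≤ Λ w²`
  have hRw_le : ∀ x, h.scalarCurvatureWith cov x * w x ^ 2 ≤ Λ * w x ^ 2 := by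
    intro x
    by_cases hxV : x ∈ V
    · obtain ⟨y, hy, rfl⟩ := hVrep x hxV
      have h2 : h.scalarCurvatureWith cov (Φ y) ≤ Λ := le_trans (le_abs_self _) (hRΛ y hy)
      exact mul_le_mul_of_nonneg_right h2 (sq_nonneg _)
    · rw [hwVc x hxV]; simp
  refine ⟨W, w, F₁, f₂, hWdef, hWsmooth, hW0, hW1, hWpos, hws, hF₁c, hf₂c, hw_nn, hw_le, hF₁_nn, hf₂_nn,
    hf₂app, ?_, ?_, hwΦ, hF₁Φ, hgrad_le, hRw_le⟩
  · intro x hx; exact hwVc x (hV ▸ hx)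
  · intro x hx; exact hF₁Vc x (hV ▸ hx)


end Summit.SmoothPoincare4.SmoothPoincare4.Theorems.SubcylindricalRecognition.AncientSphereRigidity

end
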